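import Literature.MathematicalPhysics.QuantumFieldTheory.Balaban1983to89.B11Ineq73KernelLettersLatticeFree
import Literature.MathematicalPhysics.QuantumFieldTheory.Balaban1983to89.B11Eq88KernelColumnsComposite
import Literature.MathematicalPhysics.QuantumFieldTheory.Balaban1983to89.B11Eq88LaplaceH1CurrentLetter

/-!
# `Balaban1983to89.B11Ineq88KernelLettersCompositeLatticeFree` — T. Bałaban, *The variational problem and background fields in renormalization group method
for lattice gauge theories*, Commun. Math. Phys. **102** (1985) 277–309 [Balaban1985Variational], (73) p. 289, (86)–(88) p. 291 («Applying the inequalities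
(3.132) from [5], (55), (73), and remembering that the symbol a above represents the operator of multiplication by (Lʲη)⁻² … we can estimate this functional
derivative by O(1)ε₁(Lʲη)⁻³ on Ω_j»), Prop. 4 (97)–(98) pp. 292–293; [Balaban1985Averaging] Prop. 5 (157) p. 42; [Balaban1985BackgroundPropagators] (3.122)
p. 420, (3.126) p. 420, (3.132) p. 422: **THE THREE KERNEL-COLUMN LETTERS `θ_E`, `θ₃`, `θ_E′` OF THE RE-TYPED PROPOSITION 4
(`B11Eq98W80Composite.quadAnalytic_W80_composite`) ARE LATTICE-FREE ON PRINT's CLASS, WITH ONE `(α₁, j₁, B, δ)` BEFORE THE LATTICE** — `θ_E′` is the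
`(3)/(1)`-weighted column letter of the COMPOSITE `Δπ∘(HD)′(A′)`, `Δπ := currentCLM φ lev₁ Dc (Δ̃_{a,k} − Q_k†aQ_k)` (print's `(Δ_π + DRD*)` of (87)–(88)
read as currents), `H = H̃_{1,k}`, `C = C_k`; it REPLACES the ill-posed operator-norm letter `M_Δ = ‖Δ_π‖` (lineage memo `LOCATED-after-g97.md` §2 (E′))

statement-level skeleton of published theorems with citation tags; proofs where landed; nothing here is a claim about the Yang–Mills mass gap

CITATION HEADER (lean-in-tree rule).  Audit cell `pub-balaban`, sub-cell `t4`, BINDER row NE9; NE9 crux-team LEAF PROVER 01 (`b2b-balaban-t4-ne9-formalise-leaf-01`,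
gen 98; bears_on: R4/N22), step (E′)(3b) of the lineage memo.  Composition BY NAME of: `B9Eq3126H1kPiOneBlockColumn.exists_oneBlock_letter_H1LatticeCLM` (the
one-block letter of `H̃_{1,k}`), `B11Eq88LaplaceH1CurrentLetter.exists_oneBlock_letter_laplaceH1_current` (the one-block letter of the composite
`(Δ̃_{a,k} − Q_k†aQ_k)∘H̃_{1,k}` read as currents), `B11Eq44CKernelColumnTower.norm_fderiv_Cck_single_apply_le` + `B7Eq141TorusImagesCount.sum_images_kerQdd_le`
(`C_k`'s one-bond coarse columns, [4] Prop. 5 (157) on the torus), `B11Eq73KernelColumnsCarrier.colSum_weighted_kernel_fderiv_Emap_le`,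
`B11Rem289KernelColumnsTheta3.colSum_weighted_kernel_fderiv_E3_le`, `B11Eq88KernelColumnsComposite.colSum_weighted_comp_fderiv_Emap_le` (the three abstract
column theorems).  Sources read through the audited headers of those files.  Nothing of print's proof reproduced; no constant of print valued.

WHAT IS PROVED (sorry-free; proof lane — no `def`).  **`exists_kernelLetters_composite_latticeFree`**: `∃ α₁ j₁ B δ` BEFORE (K81)'s binder block VERBATIM
through `hQ` (the two one-block letters — of `H̃_{1,k}` and of `(Δ̃_{a,k} − Q_k†aQ_k)∘H̃_{1,k}` — UNIFIED to one `(B, δ) = (max, min)`), then for every level profile ∕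
carrier data, [4] Prop. 2's data of `C_k` with Prop. 5's radius `ρ′`, every Sect. C regime `Regime H̃_{1,k} 0 C_k b 0 (C2T d α₀) ρ′ 0 a_C ε_C` with `0 < a_C`,
`ε_C + a_C ≤ ρ′`, weight-ratio bounds `ϖ` (`(3)/(3)`) and `ϖ′` (`(3)/(1)`), and the window `(ε_C + a_C)ΘΓ ≤ ½`: the THREE binders `hΘE`, `hΘ3`, `hΘ′` of
`quadAnalytic_W80_composite` hold on `‖A′‖ < a_C` with `θ_E = 2ϖΘΓℓ`, `θ₃ = (2ℓ + 1)ϖΘΓ/a_C`, `θ_E′ = 2ϖ′ΘΓℓ`, `Θ = M_φBM_φ′·d·K_d(δ)`, `Γ = C₃·2^d·2d`,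
`ℓ = (1 − 4bC₂(ε_C + a_C))⁻¹` — LATTICE-FREE (the block volume `d·L^{(n+1)d}` of the fine columns cancels `C_k`'s `L^{−(n+1)d}`; `L^{n+1}η = 1`).
HONEST SCOPE.  (i) The weight ratios `ϖ, ϖ′` and the regime's numerics stay DISPLAYED (the chart bounds them by the (115) profile letters `ω³Ω`).  (ii) Constants
crude; NOT print's `O(1)` valued; the `a_C⁻¹` of `θ₃` is the Schwarz radius of `B11Rem289KernelColumnsTheta3`, not print's.  (iii) NOT summit progress (cell
pub-balaban: NE9 NOT PRINTED ∕ NOT PROVED; «NE9 ⇐ the named binders»; row WALLED ON A MODEL (O-NE9-1; #5 UNRULED); spine PROVED 0∕9; rung (B)+1 on a finite T⁴ —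
NOT infinite volume, NOT mass gap, NOT BetaPertH, NOT Clay; HONEST DEPENDENCY: continuum YM on T⁴ ⇐ BetaPertH ∧ nine spine estimates (0/9 proved); BetaPertH ⇐
(D1) ∧ (D4) ∧ CAP+tail; G-an2-4 gates asym, D1 and NE2/3/4).  NEW file; imports `B11Ineq73KernelLettersLatticeFree`, `B11Eq88KernelColumnsComposite`,
`B11Eq88LaplaceH1CurrentLetter`; nothing modified.  Net new unproved facts: 0.
-/

noncomputable section

set_option autoImplicit false

open scoped InnerProductSpace ComplexConjugate BigOperators

namespace Literature.MathematicalPhysics.QuantumFieldTheory.Balaban1983to89.B11Ineq88KernelLettersCompositeLatticeFree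

open B4Sect5Torus (TSite tdist tdist_nonneg tdist_symm tdist_self tdist_triangle torusSum_le)
open B4Sect5Proof (latticeConst latticeConst_nonneg)
open B9SectCLatticeCarrier (Bond DirPair bpos btgt shift unshift)
open B9Eq311L2Pairing (WL2)
open B9Eq319QprimeTorus (fineP blockCoord)
open B7Prop1Explicit (U1 Wcx boxVec)
open B11Eq103H1Complex (SiteL2K BondL2K greenK covDerivL2K covDivL2K G1LatticeK KinvLatticeK H1LatticeK H1LatticeK_eq)
open B9Eq310DeltaPrime (plaqHolU)
open B9Eq310HessianOperator (adTransportW hessOp)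
open B9Eq310HessianHermitian (adTransportW_adjoint)
open B9Eq315QTorus (perCfg cornerSite)
open B9Eq315QTower (towerP UlevOf)
open B9Eq316TowerFlatIsOneStep (towerP_eq_fineP_pow siteCast)
open B9Eq326OperatorTower (QprimeTowerW QkW RofUk laplaceAk G1k)
open B9Eq324DeltaPrimeATower (laplacePrimeAk GpOfUk)
open B9Eq33CovDerivLocalLetterTower (tdist_bigBlock_bpos_btgt_le_one)
open B9Eq3117GaugeModeStencilLettersTower (local_hessOp_covDerivL2K_tower local_covDivL2K_hessOp_tower)
open B9Eq3130GtildePairRowsClosedTower (exists_local_letters_G1LatticeKPi)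
open B9Eq3132QGtildeQInvLetterClosed (exists_local_letter_KinvLatticeKPi)
open B9Eq3119DeltaPiTower (piOfUk laplaceAkPi)

open B9Eq3126H1kPiSupRowClosed (exists_local_letter_H1LatticeKPi)
open B9Eq326LocalPartTowerSupDecayDiagonalClosed (sum_bondMass_bigBlock_le)
open B11Eq103H1Complex (H1LatticeCLM H1CLM_apply funEquiv funEquiv_symm_apply)
open B11Eq115Space

open B9Eq3126H1kPiOneBlockColumn (exists_oneBlock_letter_H1LatticeCLM sum_fine_exp_block_le sum_fine_weight_exp_block_le)
open B11Eq103H1Complex (H1LatticeCLM)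
open B11Eq115Space
open B11Prop6Scheme (Prop4Hyp)
open B11Eq174Chart (Regime)
open B11Eq90Transpose (kernel single115)
open B11Eq90V0primeCurrent (flat115 flat115_apply)
open B11Eq80Current (Emap E3)
open B11Eq44COperatorTower (C2T)
open B11Eq44CLetterTower (Cck prop4Hyp_Cck)
open B11Eq44CKernelColumnTower (norm_fderiv_Cck_single_apply_le)
open B7Eq141TorusImagesCount (sum_images_kerQdd_le)
open B7Prop2Explicit (pdev AvgClosed C0 c2')
open B7Prop3Flat (c3)
open B7Prop5GeneralLevels (thetaGen C3Gen)
open B7Prop5GeneralOperators (kerQdd kerQdd_nonneg)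
open B9Eq315QTorusOnto (liftSite periodVec)
open B11Eq73KernelColumnsCarrier (colSum_weighted_kernel_fderiv_Emap_le)
open B11Rem289KernelColumnsTheta3 (colSum_weighted_kernel_fderiv_E3_le)
open B11Eq88KernelColumnsComposite (colSum_weighted_comp_fderiv_Emap_le)
open B11Eq88LaplaceH1CurrentLetter (exists_oneBlock_letter_laplaceH1_current)
open B9Eq3119DeltaPiCarrier (currentCLM)

variable {d : ℕ} (hd : 1 ≤ d) (L : ℕ) [NeZero L] (hL : 1 ≤ L) (hL3 : 3 ≤ L)
  {𝔸 : Type*} [NormedRing 𝔸] [NormedAlgebra ℂ 𝔸] [CompleteSpace 𝔸] [NormOneClass 𝔸] [StarRing 𝔸] [NormedStarGroup 𝔸] [StarModule ℂ 𝔸]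
  {W : Type*} [NormedAddCommGroup W] [InnerProductSpace ℂ W] [FiniteDimensional ℂ W] (φ : W ≃ₗ[ℂ] 𝔸)
  {Mφ Mφ' : ℝ} (hMφ : 0 ≤ Mφ) (hMφ' : 0 ≤ Mφ') (hφ : ∀ w, ‖φ w‖ ≤ Mφ * ‖w‖) (hφ' : ∀ X, ‖φ.symm X‖ ≤ Mφ' * ‖X‖) (hstar : ∀ X : 𝔸, ‖star X‖ ≤ ‖X‖)
  {a : ℝ} (ha : 0 < a) {a' : ℝ} (ha' : 0 < a') {ϱ : ℝ} (hϱ0 : 0 ≤ ϱ) (hϱ1 : ϱ < 1)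
  (τ : 𝔸 →ₗ[ℂ] ℂ) {Cτ : ℝ} (hτ : ∀ X, ‖τ X‖ ≤ Cτ * ‖X‖) (hCτ : 0 ≤ Cτ) {Mτ : ℝ} (hτm : ∀ X Y : 𝔸, ‖τ (X * Y)‖ ≤ Mτ * ‖X‖ * ‖Y‖) (hMτ : 0 ≤ Mτ)
  {ρw : ℝ} (hρw : 0 ≤ ρw)
  (hτ₁ : ∀ X : 𝔸, τ (star X) = conj (τ X)) (hτ₂ : ∀ X Y : 𝔸, τ (X * Y) = τ (Y * X)) (hφτ : ∀ X Y : 𝔸, ⟪φ.symm X, φ.symm Y⟫_ℂ = τ (star X * Y))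
  (AQ : ℝ)



set_option maxRecDepth 8192 in
set_option maxHeartbeats 2400000 in -- (K81)'s ≈ 50-binder block + the `C_k` block + the three compositions
include hd hL hL3 hMφ hMφ' hφ hφ' hstar ha ha' hϱ0 hϱ1 hτ hCτ hτm hMτ hρw hτ₁ hτ₂ hφτ in
/-- **`θ_E`, `θ₃` AND THE COMPOSITE `θ_E′` OF THE RE-TYPED PROPOSITION 4 ARE LATTICE-FREE ON PRINT's CLASS, ONE `(α₁, j₁, B, δ)` FIRST** — for the
chain's `H = H̃_{1,k}`, `C = C_k`, `Δπ = currentCLM φ lev₁ Dc (Δ̃_{a,k} − Q_k†∘(aQ_k))` in a Sect. C regime `Regime H 0 C b 0 C₂ ρ′ 0 a_C ε_C` with the window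
`(ε_C + a_C)·Θ·Γ ≤ ½`, `Θ = M_φBM_φ′·d·K_d(δ)`, `Γ = C₃·2^d·2d`: the binders `hΘE`, `hΘ3`, `hΘ′` of `B11Eq98W80Composite.quadAnalytic_W80_composite` hold on
`‖A′‖ < a_C` with `θ_E = 2ϖΘΓℓ`, `θ₃ = (2ℓ + 1)ϖΘΓ/a_C`, `θ_E′ = 2ϖ′ΘΓℓ`, `ℓ = (1 − 4bC₂(ε_C + a_C))⁻¹`, `ϖ`∕`ϖ′` any bounds of the `(3)/(3)`- ∕
`(3)/(1)`-weight ratios — NO bond count, NO `η⁻¹`.  The two one-block letters (of `H̃_{1,k}` and of `(Δ̃_{a,k} − Q_k†aQ_k)∘H̃_{1,k}`) are unified to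
`(B, δ) := (max, min)`. [cite: Balaban1985Variational, (73) p.289, (86)–(88) p.291, Prop. 4 (97)–(98) pp.292–293; Balaban1985Averaging, Prop. 5 (157) p.42; Balaban1985BackgroundPropagators, (3.122) p.420, (3.126) p.420, (3.132) p.422] -/
theorem exists_kernelLetters_composite_latticeFree :
    ∃ α₁ j₁ B δ : ℝ, 0 < α₁ ∧ 0 < j₁ ∧ 0 ≤ B ∧ 0 < δ ∧
      ∀ (n : ℕ) (η : ℝ) (_hηL : η * (L : ℝ) ^ (n + 1) = 1) (c₀ c₁ : ℝ) [Fact (0 < c₀)] [Fact (0 < c₁)]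
        (_hw : c₀ * ((L : ℝ) ^ (n + 1)) ^ d = c₁) (_hρ : |η| ^ d / c₀ ≤ ρw) (m : Fin d → ℕ) [∀ i, NeZero (m i)] (_hm : ∀ i, 1 ≤ m i)
        (U : Bond d (towerP L m (n + 1)) → 𝔸ˣ) (αU : ℕ → ℝ) (_hα0 : ∀ j, 0 ≤ αU j) (hα1 : ∀ j, αU j ≤ 1 / 64)
        (hαL : ∀ j, 50 * (d + 1) * αU j * (L : ℝ) ^ d ≤ 1 / 2)
        (hU1 : ∀ (j : ℕ) (x : B7Prop1Explicit.Site d) (k : Fin d), perCfg (towerP L m (j + 1)) (UlevOf L m (n + 1) U j) x k ∈ U1 𝔸)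
        (hreg : ∀ (j : ℕ) (y : TSite d (towerP L m j)) (k : Fin d) (ρ' : Fin d → Fin L),
          ‖((Wcx L (perCfg (towerP L m (j + 1)) (UlevOf L m (n + 1) U j)) (cornerSite L y) k (boxVec L ρ') : 𝔸ˣ) : 𝔸) - 1‖ ≤ αU j)
        (εU : ℕ → ℝ) (_hεU : ∀ j, 0 ≤ εU j) (_hUε : ∀ (j : ℕ) (b : Bond d (towerP L m (j + 1))), ‖(UlevOf L m (n + 1) U j b : 𝔸) - 1‖ ≤ εU j)
        (_hLb : ∀ (j : ℕ) (b : Bond d (towerP L m (j + 1))), UlevOf L m (n + 1) U j b ∈ U1 𝔸)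
        (α : ℝ) (_hα : 0 ≤ α) (_hαle : α ≤ α₁)
        (hUst : ∀ b, star (U b : 𝔸) = (((U b)⁻¹ : 𝔸ˣ) : 𝔸)) (_hUb : ∀ b, U b ∈ U1 𝔸) (_hUη : ∀ b, ‖(U b : 𝔸) - 1‖ ≤ α * η)
        (_hpl : ∀ p : B9SectCLatticeCarrier.Plaq d (towerP L m (n + 1)), ‖(plaqHolU U p : 𝔸) - 1‖ ≤ α * η ^ 2)
        (_hUgrad : ∀ (x : TSite d (towerP L m (n + 1))) (μ : Fin d), ‖(U (x, μ) : 𝔸) - U (unshift μ x, μ)‖ ≤ α * η ^ 2)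
        (_hRlev : ∀ (j : ℕ) (b : Bond d (towerP L m (j + 1))) (w : W), ‖adTransportW φ (UlevOf L m (n + 1) U j) b w‖ ≤ ‖w‖)
        (_hεg : ∀ j < n + 1, εU j ≤ α * ϱ ^ j) (_hAQ : ∑ j ∈ Finset.range (n + 1), αU j ≤ AQ)
        (hpos' : ∀ x : SiteL2K ℂ d (towerP L m (n + 1)) c₀ W, x ≠ 0 → 0 < RCLike.re ⟪x, laplacePrimeAk L m n φ η U a' (c₁ := c₁) x⟫_ℂ)
        (hpos : ∀ x : BondL2K ℂ d (towerP L m (n + 1)) c₀ W, x ≠ 0 →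
          0 < RCLike.re ⟪x, laplaceAk L m n φ η U hL αU hα1 hU1 hreg τ (c₀ := c₀) (c₁ := c₁) a x⟫_ℂ)
        (_hc₀η : c₀ = η ^ d) (j₀ : ℝ) (_hJ : ∀ μ y, ‖B9Eq39Adjoint.J (fun μ => B9Eq33CovDerivVector.shiftEquiv μ) (fun μ y => U (y, μ)) η μ y‖ ≤ j₀) (_hj : j₀ ≤ j₁)
        (hposπ : ∀ x : BondL2K ℂ d (towerP L m (n + 1)) c₀ W, x ≠ 0 →
          0 < RCLike.re ⟪x, laplaceAkPi L m n φ τ η U a' hpos' hL αU hα1 hU1 hreg (c₁ := c₁) a x⟫_ℂ)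
        (hQ : Function.Surjective (QkW L m n φ U hL αU hα1 hU1 hreg (c₀ := c₀) (c₁ := c₁)))
        [FiniteDimensional ℂ 𝔸] (lev₀ : Bond d (towerP L m (n + 1)) → ℕ) {κ' : Type*} [Fintype κ'] (lev₁ : κ' → ℕ)
        (Dc : (Bond d (towerP L m (n + 1)) → 𝔸) →ₗ[ℂ] (κ' → 𝔸)) (levB : Bond d m → ℕ) [Fact (0 < (L : ℝ))] [Fact (0 < η)]
        -- the `C_k`-side data ([4] Prop. 2 on `U`, the levels, the radius `ρ′` of Prop. 5's regime)
        (hL2 : 2 ≤ L) {Gr : Subgroup 𝔸ˣ} (_hGr : AvgClosed d L Gr) (_hUG : ∀ (x : B7Prop1Explicit.Site d) (κ : Fin d), perCfg (towerP L m (n + 1)) U x κ ∈ Gr)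
        {α₀ : ℝ} (_hα₀ : 0 < α₀) (_hα3 : C0 d * α₀ ≤ 1 / 3) (_hα4 : 4 * α₀ ≤ c2' d L)
        (_h52 : pdev (perCfg (towerP L m (n + 1)) U) < α₀ * (((L : ℝ) ^ (n + 1))⁻¹) ^ 2) (_hlev : ∀ b, n + 1 ≤ lev₀ b) {ρ' : ℝ}
        (_hρ' : Real.exp (4 * (800 * ((d : ℝ) + 1) ^ 2 * ((d : ℝ) + 4)) * α₀) * (1 + 8 * (131072 * ((d : ℝ) + 1) ^ 2) * ρ') ≤ 2)
        (_hρ'4 : 4 * ρ' ≤ c3 d L) (_hθ : 2 * d * thetaGen d L α₀ ≤ (L : ℝ) ^ 3 / 16) (_hC3 : 2 * d * C3Gen d L * ρ' ≤ 1)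
        -- the Sect. C regime of the pair `(H̃_{1,k}, C_k)` and the window of the kernel route
        {b aC εC : ℝ} (_RC : Regime (H1LatticeCLM (L := (L : ℝ)) (η := η) (lev₀ := lev₀) (levB := levB) φ hposπ hQ lev₁ Dc) 0
          (Cck L m η (n + 1) U lev₀ lev₁ Dc levB) b 0 (C2T d α₀) ρ' 0 aC εC)
        (_haC : 0 < aC) (_hεa : εC + aC ≤ ρ') {ϖ : ℝ} (_hϖ0 : 0 ≤ ϖ)
        (_hϖ : ∀ bb b' : Bond d (towerP L m (n + 1)), levWeight (L : ℝ) η lev₀ 3 bb / levWeight (L : ℝ) η lev₀ 3 b' ≤ ϖ) {ϖ' : ℝ} (_hϖ'0 : 0 ≤ ϖ')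
        (_hϖ' : ∀ bb b' : Bond d (towerP L m (n + 1)), levWeight (L : ℝ) η lev₀ 3 bb / levWeight (L : ℝ) η lev₀ 1 b' ≤ ϖ')
        (_hq : (εC + aC) * (Mφ * B * Mφ' * (d * latticeConst d δ)) * (C3Gen d L * (2 ^ d * (2 * d))) ≤ 1 / 2),
        (∀ A' : Space115 (L : ℝ) η lev₀ lev₁ Dc, ‖A'‖ < aC → ∀ bb : Bond d (towerP L m (n + 1)), ∑ b' : Bond d (towerP L m (n + 1)),
            levWeight (L : ℝ) η lev₀ 3 bb / levWeight (L : ℝ) η lev₀ 3 b' *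
              ‖kernel (fderiv ℂ (Emap (H1LatticeCLM (L := (L : ℝ)) (η := η) (lev₀ := lev₀) (levB := levB) φ hposπ hQ lev₁ Dc)
                (Cck L m η (n + 1) U lev₀ lev₁ Dc levB) εC) A') b' bb‖ ≤
            2 * (ϖ * (Mφ * B * Mφ' * (d * latticeConst d δ))) * (C3Gen d L * (2 ^ d * (2 * d))) * (1 / (1 - 4 * b * C2T d α₀ * (εC + aC))) * ‖A'‖) ∧
        (∀ A' : Space115 (L : ℝ) η lev₀ lev₁ Dc, ‖A'‖ < aC → ∀ bb : Bond d (towerP L m (n + 1)), ∑ b' : Bond d (towerP L m (n + 1)),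
            levWeight (L : ℝ) η lev₀ 3 bb / levWeight (L : ℝ) η lev₀ 3 b' *
              ‖kernel (fderiv ℂ (E3 (H1LatticeCLM (L := (L : ℝ)) (η := η) (lev₀ := lev₀) (levB := levB) φ hposπ hQ lev₁ Dc)
                (Cck L m η (n + 1) U lev₀ lev₁ Dc levB) εC) A') b' bb‖ ≤
            (2 * (1 / (1 - 4 * b * C2T d α₀ * (εC + aC))) + 1) * (ϖ * (Mφ * B * Mφ' * (d * latticeConst d δ))) * (C3Gen d L * (2 ^ d * (2 * d))) / aC *
              ‖A'‖ ^ 2) ∧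
        (∀ A' : Space115 (L : ℝ) η lev₀ lev₁ Dc, ‖A'‖ < aC → ∀ (bb : Bond d (towerP L m (n + 1))) (X : 𝔸), ∑ b' : Bond d (towerP L m (n + 1)),
            levWeight (L : ℝ) η lev₀ 3 bb / levWeight (L : ℝ) η lev₀ 1 b' *
              ‖NegSup.equiv (levWeight (L : ℝ) η lev₀ 3) 𝔸 (currentCLM φ lev₁ Dc
                (laplaceAkPi L m n φ τ η U a' hpos' hL αU hα1 hU1 hreg (c₁ := c₁) a
                  - LinearMap.adjoint (QkW L m n φ U hL αU hα1 hU1 hreg (c₀ := c₀) (c₁ := c₁)) ∘ₗ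
                      ((a : ℂ) • QkW L m n φ U hL αU hα1 hU1 hreg (c₀ := c₀) (c₁ := c₁)))
                (fderiv ℂ (Emap (H1LatticeCLM (L := (L : ℝ)) (η := η) (lev₀ := lev₀) (levB := levB) φ hposπ hQ lev₁ Dc)
                  (Cck L m η (n + 1) U lev₀ lev₁ Dc levB) εC) A' (single115 (lev₁ := lev₁) (Dc := Dc) bb X))) b'‖ ≤
            2 * (ϖ' * (Mφ * B * Mφ' * (d * latticeConst d δ))) * (C3Gen d L * (2 ^ d * (2 * d))) * (1 / (1 - 4 * b * C2T d α₀ * (εC + aC))) *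
              ‖A'‖ * ‖X‖) := by
  classical
  obtain ⟨α₁H, j₁H, BH, δH, hα₁H, hj₁H, hBH, hδH, HB⟩ :=
    exists_oneBlock_letter_H1LatticeCLM hd L hL hL3 φ hMφ hMφ' hφ hφ' hstar ha ha' hϱ0 hϱ1 τ hτ hCτ hτm hMτ hρw hτ₁ hτ₂ hφτ AQ
  obtain ⟨α₁N, j₁N, BN, δN, hα₁N, hj₁N, hBN, hδN, HN⟩ :=
    exists_oneBlock_letter_laplaceH1_current hd L hL hL3 φ hMφ hMφ' hφ hφ' hstar ha ha' hϱ0 hϱ1 τ hτ hCτ hτm hMτ hρw hτ₁ hτ₂ hφτ AQ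
  -- ONE letter pair for both one-block letters: `B := max B_H B_N`, `δ := min δ_H δ_N`
  refine ⟨min α₁H α₁N, min j₁H j₁N, max BH BN, min δH δN, lt_min hα₁H hα₁N, lt_min hj₁H hj₁N, hBH.trans (le_max_left _ _), lt_min hδH hδN, ?_⟩
  intro n η hηL c₀ c₁ _ _ hw hρ m _ hm U αU hα0 hα1 hαL hU1 hreg εU hεU hUε hLb α hα hαle hUst hUb hUη hpl hUgrad hRlev hεg hAQ hpos' hpos hc₀η j₀ hJ hj
    hposπ hQ _ lev₀ κ' _ lev₁ Dc levB _ _ hL2 Gr hGr hUG α₀ hα₀ hα3 hα4 h52 hlev ρ' hρ' hρ'4 hθ hC3 b aC εC RC haC hεa ϖ hϖ0 hϖ ϖ' hϖ'0 hϖ' hq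
  set B : ℝ := max BH BN with hBdef
  set δ : ℝ := min δH δN with hδdef
  have hδ : 0 < δ := lt_min hδH hδN
  have hB : 0 ≤ B := hBH.trans (le_max_left _ _)
  have hαH : α ≤ α₁H := hαle.trans (min_le_left _ _)
  have hαN : α ≤ α₁N := hαle.trans (min_le_right _ _)
  have hjH : j₀ ≤ j₁H := hj.trans (min_le_left _ _)
  have hjN : j₀ ≤ j₁N := hj.trans (min_le_right _ _)
  -- weakening a one-block letter from `(B₀, δ₀)` to `(B, δ)` with `B₀ ≤ B`, `δ ≤ δ₀`
  have hweak : ∀ {B₀ δ₀ : ℝ}, 0 ≤ B₀ → B₀ ≤ B → δ ≤ δ₀ → ∀ (t : ℝ), 0 ≤ t → ∀ (z : ℝ), 0 ≤ z →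
      Mφ * B₀ * Mφ' * Real.exp (-(δ₀ * t)) * z ≤ Mφ * B * Mφ' * Real.exp (-(δ * t)) * z := by
    intro B₀ δ₀ hB₀ hB₀B hδδ₀ t ht z hz
    have h1 : Real.exp (-(δ₀ * t)) ≤ Real.exp (-(δ * t)) :=
      Real.exp_le_exp.2 (neg_le_neg (mul_le_mul_of_nonneg_right hδδ₀ ht))
    have h2 : Mφ * B₀ * Mφ' ≤ Mφ * B * Mφ' := mul_le_mul_of_nonneg_right (mul_le_mul_of_nonneg_left hB₀B hMφ) hMφ'
    exact mul_le_mul_of_nonneg_right (mul_le_mul h2 h1 (Real.exp_nonneg _) (by positivity)) hz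
  have hη0 : 0 < η := Fact.out
  have hw3 : ∀ b' : Bond d (towerP L m (n + 1)), 0 < levWeight (L : ℝ) η lev₀ 3 b' := levWeight_pos (Fact.out : 0 < (L : ℝ)) hη0 lev₀ 3
  have hLk : (0 : ℝ) < ((L : ℝ) ^ (n + 1)) ^ d := by positivity
  have hLη : (L : ℝ) ^ (n + 1) * η = 1 := by rw [mul_comm]; exact hηL
  have hK0 : 0 ≤ latticeConst d δ := latticeConst_nonneg d hδ.le
  have hC30 : 0 ≤ C3Gen d L := by unfold C3Gen B7Prop5GeneralLevels.C1ppGen; positivity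
  -- the letters of `H̃_{1,k}`
  set hk : Bond d (towerP L m (n + 1)) → Bond d m → ℝ := fun b' y =>
    Mφ * B * Mφ' * Real.exp (-(δ * tdist m (blockCoord (L ^ (n + 1)) m (siteCast (towerP_eq_fineP_pow L m (n + 1)) (bpos b'))) (bpos y))) with hhk
  have hk0 : ∀ b' y, 0 ≤ hk b' y := fun b' y => by rw [hhk]; positivity
  have hHk : ∀ (y : Bond d m) (Z : 𝔸) (b' : Bond d (towerP L m (n + 1))),
      ‖flat115 (H1LatticeCLM (L := (L : ℝ)) (η := η) (lev₀ := lev₀) (levB := levB) φ hposπ hQ lev₁ Dc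
        ((NegSup.equiv (levWeight (L : ℝ) η levB 0) 𝔸).symm (Pi.single y Z))) b'‖ ≤ hk b' y * ‖Z‖ := fun y Z b' => by
    rw [flat115_apply, hhk]
    exact (HB n η hηL c₀ c₁ hw hρ m hm U αU hα0 hα1 hαL hU1 hreg εU hεU hUε hLb α hα hαH hUst hUb hUη hpl hUgrad hRlev hεg hAQ hpos' hpos hc₀η j₀ hJ hjH
      hposπ hQ lev₀ lev₁ Dc levB y Z b').trans (hweak hBH (le_max_left _ _) (min_le_left _ _) _ (tdist_nonneg _ _ _) _ (norm_nonneg Z))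
  -- the letters of the composite `(Δ̃_{a,k} − Q_k†aQ_k)∘H̃_{1,k}` read as currents (same `hk`)
  have hNk : ∀ (y : Bond d m) (Z : 𝔸) (b' : Bond d (towerP L m (n + 1))),
      ‖NegSup.equiv (levWeight (L : ℝ) η lev₀ 3) 𝔸 (currentCLM φ lev₁ Dc
          (laplaceAkPi L m n φ τ η U a' hpos' hL αU hα1 hU1 hreg (c₁ := c₁) a
            - LinearMap.adjoint (QkW L m n φ U hL αU hα1 hU1 hreg (c₀ := c₀) (c₁ := c₁)) ∘ₗ
                ((a : ℂ) • QkW L m n φ U hL αU hα1 hU1 hreg (c₀ := c₀) (c₁ := c₁)))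
          (H1LatticeCLM (L := (L : ℝ)) (η := η) (lev₀ := lev₀) (levB := levB) φ hposπ hQ lev₁ Dc
            ((NegSup.equiv (levWeight (L : ℝ) η levB 0) 𝔸).symm (Pi.single y Z)))) b'‖ ≤ hk b' y * ‖Z‖ := fun y Z b' => by
    rw [hhk]
    exact (HN n η hηL c₀ c₁ hw hρ m hm U αU hα0 hα1 hαL hU1 hreg εU hεU hUε hLb α hα hαN hUst hUb hUη hpl hUgrad hRlev hεg hAQ hpos' hpos hc₀η j₀ hJ hjN
      hposπ hQ lev₀ lev₁ Dc levB y Z b').trans (hweak hBN (le_max_right _ _) (min_le_right _ _) _ (tdist_nonneg _ _ _) _ (norm_nonneg Z))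
  set ΘH : ℝ := Mφ * B * Mφ' * (d * ((L : ℝ) ^ (n + 1)) ^ d * latticeConst d δ) with hΘH
  have hΘH0 : 0 ≤ ΘH := by rw [hΘH]; positivity
  have hH1 : ∀ y, ∑ b', hk b' y ≤ ΘH := fun y => by
    rw [hΘH, hhk]
    simp only []
    rw [← Finset.mul_sum]
    exact mul_le_mul_of_nonneg_left (sum_fine_exp_block_le L n m hm hδ (bpos y)) (by positivity)
  have hHw : ∀ (bb : Bond d (towerP L m (n + 1))) (y : Bond d m), ∑ b', levWeight (L : ℝ) η lev₀ 3 bb / levWeight (L : ℝ) η lev₀ 3 b' * hk b' y ≤ ϖ * ΘH := by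
    intro bb y
    rw [hΘH, hhk]
    simp only []
    have h := sum_fine_weight_exp_block_le hd L n m hm hδ (bpos y) (r := fun b' => levWeight (L : ℝ) η lev₀ 3 bb / levWeight (L : ℝ) η lev₀ 3 b' * (Mφ * B * Mφ'))
      (ϖ := ϖ * (Mφ * B * Mφ')) (fun b' => mul_nonneg (div_nonneg (hw3 bb).le (hw3 b').le) (by positivity))
      (fun b' => mul_le_mul_of_nonneg_right (hϖ bb b') (by positivity))
    calc _ = ∑ b', levWeight (L : ℝ) η lev₀ 3 bb / levWeight (L : ℝ) η lev₀ 3 b' * (Mφ * B * Mφ') *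
          Real.exp (-(δ * tdist m (blockCoord (L ^ (n + 1)) m (siteCast (towerP_eq_fineP_pow L m (n + 1)) (bpos b'))) (bpos y))) :=
          Finset.sum_congr rfl fun b' _ => by ring
      _ ≤ _ := h
      _ = _ := by ring
  have hw1 : ∀ b' : Bond d (towerP L m (n + 1)), 0 < levWeight (L : ℝ) η lev₀ 1 b' := levWeight_pos (Fact.out : 0 < (L : ℝ)) hη0 lev₀ 1
  have hHw' : ∀ (bb : Bond d (towerP L m (n + 1))) (y : Bond d m), ∑ b', levWeight (L : ℝ) η lev₀ 3 bb / levWeight (L : ℝ) η lev₀ 1 b' * hk b' y ≤ ϖ' * ΘH := by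
    intro bb y
    rw [hΘH, hhk]
    simp only []
    have h := sum_fine_weight_exp_block_le hd L n m hm hδ (bpos y) (r := fun b' => levWeight (L : ℝ) η lev₀ 3 bb / levWeight (L : ℝ) η lev₀ 1 b' * (Mφ * B * Mφ'))
      (ϖ := ϖ' * (Mφ * B * Mφ')) (fun b' => mul_nonneg (div_nonneg (hw3 bb).le (hw1 b').le) (by positivity))
      (fun b' => mul_le_mul_of_nonneg_right (hϖ' bb b') (by positivity))
    calc _ = ∑ b', levWeight (L : ℝ) η lev₀ 3 bb / levWeight (L : ℝ) η lev₀ 1 b' * (Mφ * B * Mφ') *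
          Real.exp (-(δ * tdist m (blockCoord (L ^ (n + 1)) m (siteCast (towerP_eq_fineP_pow L m (n + 1)) (bpos b'))) (bpos y))) :=
          Finset.sum_congr rfl fun b' _ => by ring
      _ ≤ _ := h
      _ = _ := by ring
  -- the letters of `C_k`
  set gC : Bond d m → Bond d (towerP L m (n + 1)) → ℝ := fun c bb =>
    C3Gen d L * ∑ t ∈ (Fintype.piFinset fun _ : Fin d => ({0, 1} : Finset ℤ)),
      kerQdd L (n + 1) (liftSite c.1) c.2 (liftSite bb.1 + periodVec (towerP L m (n + 1)) t) bb.2 with hgC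
  have hgC0 : ∀ c bb, 0 ≤ gC c bb := fun c bb => by
    rw [hgC]
    exact mul_nonneg hC30 (Finset.sum_nonneg fun t _ => kerQdd_nonneg L (n + 1) (liftSite c.1) c.2 _ bb.2)
  have hCg : ∀ A : Space115 (L : ℝ) η lev₀ lev₁ Dc, ‖A‖ < εC + aC → ∀ (bb : Bond d (towerP L m (n + 1))) (X : 𝔸) (c : Bond d m),
      ‖NegSup.equiv (levWeight (L : ℝ) η levB 0) 𝔸 (fderiv ℂ (Cck L m η (n + 1) U lev₀ lev₁ Dc levB) A (single115 (lev₁ := lev₁) (Dc := Dc) bb X)) c‖ ≤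
        gC c bb * ‖A‖ * ‖X‖ := by
    intro A hA bb X c
    have h := norm_fderiv_Cck_single_apply_le L m η (n + 1) U lev₀ lev₁ Dc levB hL2 hGr hUG hα₀ hα3 hα4 h52 hlev hρ' hρ'4 hθ hC3 (lt_of_lt_of_le hA hεa) bb X c
    rw [hLη, mul_one] at h
    refine h.trans (le_of_eq ?_)
    rw [hgC]
    simp only []
    ring
  set G : ℝ := C3Gen d L * (2 ^ d * (2 * d) * (((L : ℝ) ^ (n + 1)) ^ d)⁻¹) with hGdef
  have hG : ∀ bb, ∑ c, gC c bb ≤ G := fun bb => by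
    rw [hGdef, hgC]
    simp only []
    rw [← Finset.mul_sum]
    exact mul_le_mul_of_nonneg_left (sum_images_kerQdd_le L m (n + 1) (le_trans (by norm_num) hL2) bb) hC30
  -- the product of the two letters is lattice-free
  have hprod : ΘH * G = (Mφ * B * Mφ' * (d * latticeConst d δ)) * (C3Gen d L * (2 ^ d * (2 * d))) := by
    rw [hΘH, hGdef]; field_simp
  have hq' : (εC + aC) * ΘH * G ≤ 1 / 2 := by rw [mul_assoc, hprod, ← mul_assoc]; exact hq
  have hC : Prop4Hyp (Cck L m η (n + 1) U lev₀ lev₁ Dc levB) (C2T d α₀) ρ' :=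
    prop4Hyp_Cck L m η (n + 1) U lev₀ lev₁ Dc levB hL2 hGr hUG hα₀ hα3 hα4 h52 hlev hρ' (by linarith [RC.ε₄_nonneg])
  refine ⟨fun A' hA' bb => ?_, fun A' hA' bb => ?_, fun A' hA' bb X => ?_⟩
  · have h := colSum_weighted_kernel_fderiv_Emap_le RC hC hk0 hHk hH1 hgC0 hCg hG hq' hΘH0 (by positivity) hHw hA' bb
    refine h.trans (le_of_eq ?_)
    linear_combination (2 * ϖ * (1 / (1 - 4 * b * C2T d α₀ * (εC + aC))) * ‖A'‖) * hprod
  · have h := colSum_weighted_kernel_fderiv_E3_le RC hC haC hk0 hHk hΘH0 hH1 (by positivity) hHw hgC0 hCg hG hq' hA' bb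
    refine h.trans (le_of_eq ?_)
    linear_combination ((2 * (1 / (1 - 4 * b * C2T d α₀ * (εC + aC))) + 1) * ϖ / aC * ‖A'‖ ^ 2) * hprod
  · have h := colSum_weighted_comp_fderiv_Emap_le RC hC hk0 hHk hH1 hgC0 hCg hG hq' _ hk0 hNk hΘH0 bb
      (r := fun b' => levWeight (L : ℝ) η lev₀ 3 bb / levWeight (L : ℝ) η lev₀ 1 b') (fun b' => div_nonneg (hw3 bb).le (hw1 b').le)
      (by positivity) (hHw' bb) hA' X
    refine h.trans (le_of_eq ?_)
    linear_combination (2 * ϖ' * (1 / (1 - 4 * b * C2T d α₀ * (εC + aC))) * ‖A'‖ * ‖X‖) * hprod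

end Literature.MathematicalPhysics.QuantumFieldTheory.Balaban1983to89.B11Ineq88KernelLettersCompositeLatticeFree

end
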